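import Summits.HodgeConjecture.HodgeConjecture.Theorems.K2E3BranchBSkewLineCharacterIntegral   -- ★ (II)-b2 «Φ₁» (this seat); brings ★ (II)-b3a `K2E3BranchBSkewLineIntegrals` (the `σ`-fixed fibres, `conj_half_mul_conj_and_valued`, `valued_heisZ_apply_eq_max`), ★ (II)-b1 `K2E3BranchBSkewUnitSign` (`apply_inv_map_eq`, `forall_placesOver_of_apply`), ★ Z2A-3b `isUnit_of_apply_ne_zero`, ★ `unitModulusChar_eq_one_of_forall_v_eq_one`, ★ `HeisRing.heisZ`
import HarnessLib

/-!
# K2 ∕ E3 «EllipticInputs», unit U4 «Keys» — socket :155 (depth 0, Branch B), step Z3-c (II)-b3 support «SHELL-ZERO FIBRES»: on the shell `|z|_w = 1` the Casselman integrand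
# `F₀` IS `χ₁(ẑ)`, and its `y`-fibres in the Heisenberg chart `z = heisZ σ x y = y − ½xσx` are `Φ₁⁺` (`|x|_w = 1`), `χ₁(δ₀)·μ⁻{|y|_w = 1}` (`|x|_w < 1`), `0` (`|x|_w > 1`)

Cell hodgecm-mathlib (D-0151), FLOOR 0, Track B «K2-LIT», engine E3, crux item H413 = stmt-HodgeConjecture-24833 (route `HCCMUnconditional`, no route verbs); target BY NAME the
OPEN socket `…U4Keys.sig_K2E3KeysThmTwoContractingRamifiedCharOneDepthZeroNormTrivial` (:155; Keys §7 Thm. (2), ramified `χ₁` of depth 0 with `χ₁ ∘ N = 1` on units = BRANCH B),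
step Z3-c of `PAPER-Z3-DepthZeroInert`, support brick for (II)-b3 `K2E3BranchBShellZero` (K2E3-p03 (g9)'s head `∫_{|z n|_w = 1} F₀ dμN = −ε₀·((q−1)∕q²)·V`, frame
`K2/K2E3-p03/g9/Z3c-frame.v1.txt`), typed by the S1 hand R90-C10-p04 (g0) while the (II)-b3 holder is not yet resumed after the 2026-09-04 hub outage — so that the chart
assembly (`μN = κ • heisHaar μR μ⁻`, Fubini over `R × R⁻`) has every `y`-fibre BY NAME.  `--supports stmt-HodgeConjecture-24833 --as helper`; THEOREMS ONLY (no `def`, no `instance`,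
no notation, no named-fact hypothesis, no `sorry`).  NOT THE PAYER.

FRAME (v1 spellings): `R := LocalRing L v`, `σ := conjLocal L c v`, `R⁻ = skewPart σ`; `v` non-split (`hw`), unramified (`hunr`), `v ∤ 2` (`h2w`, `[Invertible (2 : R)]`); the :155 letters `hdepth`,
`hB`; `δ₀` (`hδσ`, `hδv`); `μ⁻ = μY` any (regular additive Haar) measure on `R⁻`.  `E r := χ₁(r̂)` if `r ∈ Rˣ` else `0`; `F₀` the frame-v1 integrand
`r ↦ χ₁(σ r̂)⁻¹ · ‖r̂‖_R⁻¹` if `r ∈ Rˣ` else `0`, read at `r = z n`.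
* §1 **`shellZeroIntegrand_eq_dite_chi`** — on `|r_w| = 1`: `F₀ r = E r` (`χ₁((σ r̂)⁻¹) = χ₁(r̂)` is Branch B ★ `apply_inv_map_eq`; `‖r̂‖_R = 1` ★ `unitModulusChar_eq_one_of_forall_v_eq_one`);
  **`setIntegral_heisZ_shellZeroIntegrand_eq`** — hence the `y`-fibre of `F₀ ∘ z` over `{|heisZ σ x y|_w = 1}` equals that of `E ∘ z`.
* §2 the three `y`-FIBRES of `E ∘ z`: `heisZ σ x y = a + y` with `a = −½xσx` `σ`-FIXED and `|a|_w = |x|_w²` (★ `conj_half_mul_conj_and_valued`), so ★ (II)-b3a's `σ`-fixed fibres apply: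
  **`heisZFibre_eq_of_valued_eq_one`** (`|x|_w = 1`: `= Φ₁⁺ := ∫_{|y|_w ≤ 1} E(1 + y) dμ⁻`), **`heisZFibre_eq_of_valued_lt_one`** (`|x|_w < 1`: `= χ₁(δ₀) · μ⁻.real{|y|_w = 1}`),
  **`heisZFibre_eq_zero_of_one_lt_valued`** (`|x|_w > 1`: `= 0`).
With ★ «Φ₁» (`Φ₁⁺ = −χ₁(δ₀)·μ⁻.real{|y|_w < 1}`, ★ `setIntegral_skewBall_dite_chiInv_one_add` ∘ ★ `setIntegral_dite_inv_one_add_eq`) and the ball ratios ★ L-β0, the assembler's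
`x`-integral is `μR{|x| = 1}·Φ₁⁺ + μR{|x| < 1}·χ₁(δ₀)·μ⁻{|y| = 1} = −χ₁(δ₀)·(q−1)q⁻²·μR(𝒪)μ⁻(𝒪⁻)` — the number of `PAPER-Z3` §1.

HONEST LABEL: HC_CM is proved only modulo the 7 printed citations (2 remaining named inputs: hLiu418 = stmt-HodgeConjecture-24832, h413 = stmt-HodgeConjecture-24833)
until rung 0 closes; count-neutral — this file does NOT pay the socket; no printed citation is discharged.

## References
* [Keys1984] D. Keys, *Principal series representations of special unitary groups over local fields*, Compositio Math. 51 (1984), §4–§5, §7 Thm. (2) p. 126.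
* [Casselman1980] W. Casselman, *The unramified principal series of p-adic groups I*, Compositio Math. 40 (1980), §3.
* [Rogawski1990] J. Rogawski, *Automorphic representations of unitary groups in three variables*, Ann. of Math. Stud. 123 (1990), §1.10 p. 9 (`u(x, z)`, `z + σz + xσx = 0`), §12.2 (2) p. 173.
* [GetzHahn2024] J. Getz, H. Hahn, *An Introduction to Automorphic Representations*, GTM 300 (2024), §3.5.
-/

set_option autoImplicit false
-- the mandated namespace has the single-problem summit's repeated segment (`HodgeConjecture.HodgeConjecture`)
set_option linter.dupNamespace false

noncomputable section

open NumberField IsDedekindDomain MeasureTheory Measure Topology Set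
open scoped NNReal ENNReal
open Literature.NumberTheory Literature.NumberTheory.Automorphic Literature.NumberTheory.Automorphic.UnitaryGroup

namespace Summit.HodgeConjecture.HodgeConjecture.Cruxes.H413.K2E3BranchBShellZeroFibres

open Summit.HodgeConjecture.HodgeConjecture.Cruxes.H413
open Summit.HodgeConjecture.HodgeConjecture.Cruxes.H413.K2E3BranchBSkewUnitSign
open Summit.HodgeConjecture.HodgeConjecture.Cruxes.H413.K2E3BranchBSkewLineIntegrals

variable (L : Type) [Field L] [NumberField L] [IsCMField L] (v : HeightOneSpectrum (𝓞 ↥(maximalRealSubfield L)))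
  (w : PlacesOver L v) (hw : IsCMField.complexConj L • w.1 = w.1)

/-! ## §1 On the unit sphere the Casselman integrand `F₀` is `χ₁(ẑ)` -/

include hw in
open scoped Classical in
/-- **`F₀ r = E r` on `|r_w| = 1`**: `r` is a unit (★ `isUnit_of_apply_ne_zero`), `χ₁((σ r̂)⁻¹) = χ₁(r̂)` by Branch B (★ `apply_inv_map_eq`) and `‖r̂‖_R = 1` (★ `unitModulusChar_eq_one_of_forall_v_eq_one`).
This is the frame-v1 integrand `F₀` read on the shell `|z n|_w = 1` (★ `K2E3BranchBCasselmanPairIntegrands`, `χ₂(−1)` removed). [cite: Keys1984, §7 Theorem (2) p. 126] [cite: Casselman1980, §3] -/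
theorem shellZeroIntegrand_eq_dite_chi (χ₁ : (LocalRing L v)ˣ →* ℂˣ)
    (hB : ∀ u : (LocalRing L v)ˣ, (∀ w' : PlacesOver L v, Valued.v ((u : LocalRing L v) w') = 1) →
      χ₁ (u * Units.map (conjLocal L (IsCMField.complexConj L) v : LocalRing L v →* LocalRing L v) u) = 1)
    {r : LocalRing L v} (hr : Valued.v (r w) = 1) :
    (if h : IsUnit r then
        ((((χ₁ (Units.map (conjLocal L (IsCMField.complexConj L) v : LocalRing L v →* LocalRing L v) h.unit))⁻¹ : ℂˣ) : ℂ) *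
          ((((unitModulusChar (LocalRing L v) h.unit)⁻¹ : ℝ≥0) : ℝ) : ℂ))
      else 0) =
      (if h : IsUnit r then ((χ₁ h.unit : ℂˣ) : ℂ) else 0) := by
  have hu : IsUnit r := K2E3DepthZeroIwahoriCharacterCM.isUnit_of_apply_ne_zero L v w hw r (fun h0 => by rw [h0, map_zero] at hr; exact zero_ne_one hr)
  have hv : Valued.v ((hu.unit : LocalRing L v) w) = 1 := by rw [IsUnit.unit_spec]; exact hr
  rw [dif_pos hu, dif_pos hu, ← map_inv, apply_inv_map_eq L v w hw χ₁ hB hu.unit hv,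
    unitModulusChar_eq_one_of_forall_v_eq_one L v hu.unit (forall_placesOver_of_apply L v w hw hv), inv_one, NNReal.coe_one, Complex.ofReal_one, mul_one]

/-- `heisZ σ x y = −½xσx + y` (★ `HeisRing.heisZ` unfolded and commuted). [cite: Rogawski1990, §1.10 p. 9] -/
theorem heisZ_eq_neg_half_add [Invertible (2 : LocalRing L v)] (x y : LocalRing L v) :
    HeisRing.heisZ (conjLocal L (IsCMField.complexConj L) v) x y = -(⅟ (2 : LocalRing L v) * (x * conjLocal L (IsCMField.complexConj L) v x)) + y := by
  rw [HeisRing.heisZ]; ring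

/-! ## §2 The `y`-fibres of `E ∘ z` in the Heisenberg chart `z = heisZ σ x y = −½xσx + y` -/

section Fibres

variable [MeasurableSpace (LocalRing L v)] [BorelSpace (LocalRing L v)]
  (μY : Measure ↥(HeisRing.skewPart (conjLocal L (IsCMField.complexConj L) v))) [μY.IsAddHaarMeasure] [μY.Regular]

omit [μY.IsAddHaarMeasure] [μY.Regular] in
include hw in
open scoped Classical in
/-- **`F₀ ∘ z` and `E ∘ z` have the same `y`-fibre over the shell**: `∫_{y : |heisZ σ x y|_w = 1} F₀(heisZ σ x y) dμ⁻ = ∫_{y : |heisZ σ x y|_w = 1} E(heisZ σ x y) dμ⁻` (§1 pointwise on the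
measurable fibre set). [cite: Keys1984, §7 Theorem (2) p. 126] [cite: Casselman1980, §3] -/
theorem setIntegral_heisZ_shellZeroIntegrand_eq [Invertible (2 : LocalRing L v)] (χ₁ : (LocalRing L v)ˣ →* ℂˣ)
    (hB : ∀ u : (LocalRing L v)ˣ, (∀ w' : PlacesOver L v, Valued.v ((u : LocalRing L v) w') = 1) →
      χ₁ (u * Units.map (conjLocal L (IsCMField.complexConj L) v : LocalRing L v →* LocalRing L v) u) = 1)
    (x : LocalRing L v) :
    ∫ y in {y : ↥(HeisRing.skewPart (conjLocal L (IsCMField.complexConj L) v)) |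
        Valued.v ((HeisRing.heisZ (conjLocal L (IsCMField.complexConj L) v) x (y : LocalRing L v)) w) = 1},
        (fun r : LocalRing L v => if h : IsUnit r then
          ((((χ₁ (Units.map (conjLocal L (IsCMField.complexConj L) v : LocalRing L v →* LocalRing L v) h.unit))⁻¹ : ℂˣ) : ℂ) *
            ((((unitModulusChar (LocalRing L v) h.unit)⁻¹ : ℝ≥0) : ℝ) : ℂ))
          else 0) (HeisRing.heisZ (conjLocal L (IsCMField.complexConj L) v) x (y : LocalRing L v)) ∂μY =
      ∫ y in {y : ↥(HeisRing.skewPart (conjLocal L (IsCMField.complexConj L) v)) |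
        Valued.v ((HeisRing.heisZ (conjLocal L (IsCMField.complexConj L) v) x (y : LocalRing L v)) w) = 1},
        (fun r : LocalRing L v => if h : IsUnit r then ((χ₁ h.unit : ℂˣ) : ℂ) else 0)
          (HeisRing.heisZ (conjLocal L (IsCMField.complexConj L) v) x (y : LocalRing L v)) ∂μY := by
  have hS : MeasurableSet {r : LocalRing L v | Valued.v (r w) = 1} := by
    have h1 : {r : LocalRing L v | Valued.v (r w) = 1} = {r : LocalRing L v | Valued.v (r w) ≤ 1} \ {r : LocalRing L v | Valued.v (r w) < 1} := by
      ext r; simp only [Set.mem_setOf_eq, Set.mem_sdiff, not_lt]; exact ⟨fun h => ⟨h.le, h.ge⟩, fun h => le_antisymm h.1 h.2⟩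
    rw [h1]
    exact (isClosed_setOf_valued_apply_le_one L v w).measurableSet.diff (isOpen_setOf_valued_apply_lt_one L v w).measurableSet
  have hcont : Continuous fun y : ↥(HeisRing.skewPart (conjLocal L (IsCMField.complexConj L) v)) =>
      HeisRing.heisZ (conjLocal L (IsCMField.complexConj L) v) x (y : LocalRing L v) := by
    simp only [heisZ_eq_neg_half_add]
    exact continuous_const.add continuous_subtype_val
  have hmeas : MeasurableSet {y : ↥(HeisRing.skewPart (conjLocal L (IsCMField.complexConj L) v)) |
      Valued.v ((HeisRing.heisZ (conjLocal L (IsCMField.complexConj L) v) x (y : LocalRing L v)) w) = 1} := hS.preimage hcont.measurable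
  refine setIntegral_congr_fun hmeas fun y hy => ?_
  exact shellZeroIntegrand_eq_dite_chi L v w hw χ₁ hB hy

include hw in
open scoped Classical in
/-- **FIBRE `|x|_w = 1`: `∫_{y : |heisZ σ x y|_w = 1} E(heisZ σ x y) dμ⁻ = Φ₁⁺ = ∫_{|y|_w ≤ 1} E(1 + y) dμ⁻`** — `heisZ σ x y = a + y` with `a = −½xσx` `σ`-fixed, `|a|_w = |x|_w² = 1`
(★ `conj_half_mul_conj_and_valued`), then ★ `skewLineIntegral_eq_of_valued_eq_one`. [cite: Keys1984, §4, §7 Theorem (2) p. 126] [cite: Rogawski1990, §1.10 p. 9] -/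
theorem heisZFibre_eq_of_valued_eq_one [Invertible (2 : LocalRing L v)] (h2w : Valued.v (2 : w.1.adicCompletion L) = 1)
    (hunr : Algebra.IsUnramifiedIn (𝓞 L) v.asIdeal) (χ₁ : (LocalRing L v)ˣ →* ℂˣ)
    (hB : ∀ u : (LocalRing L v)ˣ, (∀ w' : PlacesOver L v, Valued.v ((u : LocalRing L v) w') = 1) →
      χ₁ (u * Units.map (conjLocal L (IsCMField.complexConj L) v : LocalRing L v →* LocalRing L v) u) = 1)
    {x : LocalRing L v} (hx : Valued.v (x w) = 1) :
    ∫ y in {y : ↥(HeisRing.skewPart (conjLocal L (IsCMField.complexConj L) v)) |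
        Valued.v ((HeisRing.heisZ (conjLocal L (IsCMField.complexConj L) v) x (y : LocalRing L v)) w) = 1},
        (fun r : LocalRing L v => if h : IsUnit r then ((χ₁ h.unit : ℂˣ) : ℂ) else 0)
          (HeisRing.heisZ (conjLocal L (IsCMField.complexConj L) v) x (y : LocalRing L v)) ∂μY =
      ∫ y in {y : ↥(HeisRing.skewPart (conjLocal L (IsCMField.complexConj L) v)) | Valued.v ((y : LocalRing L v) w) ≤ 1},
        (fun r : LocalRing L v => if h : IsUnit r then ((χ₁ h.unit : ℂˣ) : ℂ) else 0) (1 + (y : LocalRing L v)) ∂μY := by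
  obtain ⟨hfix, hval⟩ := conj_half_mul_conj_and_valued L v w hw h2w x
  simp only [heisZ_eq_neg_half_add]
  exact skewLineIntegral_eq_of_valued_eq_one L v w hw μY h2w hunr χ₁ hB hfix (by rw [hval, hx, one_mul])

omit [μY.IsAddHaarMeasure] [μY.Regular] in
include hw in
open scoped Classical in
/-- **FIBRE `|x|_w < 1`: `∫_{y : |heisZ σ x y|_w = 1} E(heisZ σ x y) dμ⁻ = χ₁(δ₀) · μ⁻.real{|y|_w = 1}`** (`|a|_w = |x|_w² < 1`, ★ `skewLineIntegral_eq_of_valued_lt_one`: the fibre is the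
skew unit sphere, where `χ₁(ẑ) = χ₁(ŷ) = χ₁(δ₀)`). [cite: Keys1984, §4, §7 Theorem (2) p. 126] [cite: Rogawski1990, §1.10 p. 9] -/
theorem heisZFibre_eq_of_valued_lt_one [Invertible (2 : LocalRing L v)] (h2w : Valued.v (2 : w.1.adicCompletion L) = 1)
    (hunr : Algebra.IsUnramifiedIn (𝓞 L) v.asIdeal) (χ₁ : (LocalRing L v)ˣ →* ℂˣ)
    (hdepth : ∀ u : (LocalRing L v)ˣ, (∀ w' : PlacesOver L v, Valued.v (((u : LocalRing L v) w') - 1) < 1) → χ₁ u = 1)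
    (hB : ∀ u : (LocalRing L v)ˣ, (∀ w' : PlacesOver L v, Valued.v ((u : LocalRing L v) w') = 1) →
      χ₁ (u * Units.map (conjLocal L (IsCMField.complexConj L) v : LocalRing L v →* LocalRing L v) u) = 1)
    (δ₀ : (LocalRing L v)ˣ) (hδσ : conjLocal L (IsCMField.complexConj L) v (δ₀ : LocalRing L v) = -(δ₀ : LocalRing L v))
    (hδv : Valued.v ((δ₀ : LocalRing L v) w) = 1)
    {x : LocalRing L v} (hx : Valued.v (x w) < 1) :
    ∫ y in {y : ↥(HeisRing.skewPart (conjLocal L (IsCMField.complexConj L) v)) |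
        Valued.v ((HeisRing.heisZ (conjLocal L (IsCMField.complexConj L) v) x (y : LocalRing L v)) w) = 1},
        (fun r : LocalRing L v => if h : IsUnit r then ((χ₁ h.unit : ℂˣ) : ℂ) else 0)
          (HeisRing.heisZ (conjLocal L (IsCMField.complexConj L) v) x (y : LocalRing L v)) ∂μY =
      ((χ₁ δ₀ : ℂˣ) : ℂ) *
        (μY.real {y : ↥(HeisRing.skewPart (conjLocal L (IsCMField.complexConj L) v)) | Valued.v ((y : LocalRing L v) w) = 1} : ℂ) := by
  obtain ⟨hfix, hval⟩ := conj_half_mul_conj_and_valued L v w hw h2w x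
  simp only [heisZ_eq_neg_half_add]
  exact skewLineIntegral_eq_of_valued_lt_one L v w hw μY h2w hunr χ₁ hdepth hB δ₀ hδσ hδv hfix
    (by rw [hval]; exact mul_self_lt_one_iff.2 hx)

omit [BorelSpace (LocalRing L v)] [μY.IsAddHaarMeasure] [μY.Regular] in
include hw in
open scoped Classical in
/-- **FIBRE `|x|_w > 1`: the `y`-fibre of `E ∘ z` over the shell is `0`** (`|a|_w = |x|_w² > 1`: the fibre set is empty, ★ `skewLineIntegral_eq_zero_of_one_lt_valued`).
[cite: Keys1984, §7] [cite: Rogawski1990, §1.10 p. 9] -/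
theorem heisZFibre_eq_zero_of_one_lt_valued [Invertible (2 : LocalRing L v)] (h2w : Valued.v (2 : w.1.adicCompletion L) = 1)
    (χ₁ : (LocalRing L v)ˣ →* ℂˣ) {x : LocalRing L v} (hx : 1 < Valued.v (x w)) :
    ∫ y in {y : ↥(HeisRing.skewPart (conjLocal L (IsCMField.complexConj L) v)) |
        Valued.v ((HeisRing.heisZ (conjLocal L (IsCMField.complexConj L) v) x (y : LocalRing L v)) w) = 1},
        (fun r : LocalRing L v => if h : IsUnit r then ((χ₁ h.unit : ℂˣ) : ℂ) else 0)
          (HeisRing.heisZ (conjLocal L (IsCMField.complexConj L) v) x (y : LocalRing L v)) ∂μY = 0 := by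
  obtain ⟨hfix, hval⟩ := conj_half_mul_conj_and_valued L v w hw h2w x
  simp only [heisZ_eq_neg_half_add]
  exact skewLineIntegral_eq_zero_of_one_lt_valued L v w hw μY h2w χ₁ hfix (by rw [hval]; exact one_lt_mul_self_iff.2 hx)

end Fibres

end Summit.HodgeConjecture.HodgeConjecture.Cruxes.H413.K2E3BranchBShellZeroFibres

end
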